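import Literature.AlgebraicGeometry.Resolution.GeneralizedStabilityRankOneVTPairs
import HarnessLib

/-!
# Ostrowski's lemma I: the ramification lemma and conjugates over a henselian field

Topic: `Literature/AlgebraicGeometry/Resolution` (valued function fields). First file of the
discharge of the named fact `Kuhlmann2010OstrowskiLemma`
(`GeneralizedStabilityHenselizedRational.lean`) = the **Lemma of Ostrowski** as quoted by
F.-V. Kuhlmann, *Elimination of ramification I: The generalized stability theorem*, Trans. AMS
362 (2010) 5697–5727 = arXiv:1003.5678, §2.3, (9):

> Assume that `(L|K,v)` is a finite extension and the extension of `v` from `K` to `L` is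
> unique. Then the Lemma of Ostrowski says that `[L:K] = (vL:vK)·[Lv:Kv]·p^ν` with `ν ≥ 0`
> where `p` is the characteristic exponent of `Kv` … (cf. [En], [R]).

The source prints no proof. We follow the classical route of O. Zariski – P. Samuel,
*Commutative Algebra* II, Ch. VI §12 (Thm. 24: "`G_V` is a `π`-group", proved by a trace
argument; Thm. 25, Corollary: "The product `efg` divides the degree `n = [K*:K]`, and `n/efg` is
a power of `π`"), reorganised so that only FINITE Galois theory, Sylow subgroups and the
conjugation of embeddings over a henselian field are needed (no ramification groups as such):
this file supplies the two local ingredients.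

## Content (everything PROVED)

* `valuation_pow_apply_sub_lt` and **`ringHom_apply_eq_self_of_valuation_sub_lt` — the
  ramification lemma** (the trace argument of ZS VI §12, Thm. 24): a ring endomorphism `σ` of
  a valued field `(N, v)` with `σ^q = 1`, `v(q) = 1` and `v(σx - x) < v(x)` for all `x ≠ 0` is
  the identity. (With `T = ∑_{i<q} σ^i`: for `σ x ≠ x` the element `y = q x - T x ≠ 0` has
  `T y = 0`, while `v(T y - q y) < v(y) = v(q y)`.)
* Over a HENSELIAN subfield `F ≤ Ω` (`IsHenselianField`, `Henselization.lean`: the valuation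
  ring extends uniquely to algebraic extensions), for an algebraic `F`-algebra `E → Ω` and an
  `F`-embedding `φ : E → Ω`: `IsHenselianField.mem_iff_of_algHom` (`φ z ∈ V ↔ z ∈ V`),
  `IsHenselianField.isEquiv_comap_algHom`, `IsHenselianField.valuation_algHom_lt_one_iff`,
  **`IsHenselianField.valuation_algHom_apply`** (`v(φ z) = v(z)`: conjugates over a henselian
  field have the same value; through `v(zⁿ) ∈ vF`, `exists_valuation_pow_eq_of_isAlgebraic`,
  and injectivity of `γ ↦ γⁿ` on the value group).
* `IsHenselianField.of_subfield_le` — henselianity passes to algebraic extensions inside `Ω`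
  (Kuhlmann 2010, Lemma 2.3).
* `valuation_sub_lt_of_isImmediateOver` — for an IMMEDIATE extension `M ≤ N` inside `(Ω, V)`
  and a value-preserving ring endomorphism `s` of `N` fixing `M`: `v(s x - x) < v(x)` for
  `x ≠ 0` (write `x = c d + r` with `c, d ∈ M`, `v(r) < v(x)`).

## Sources

* F.-V. Kuhlmann, Trans. AMS 362 (2010) = arXiv:1003.5678, §1.1 (henselian fields), §2.3 (9)
  (the Lemma of Ostrowski), Lemma 2.3. [Kuhlmann2010]
* O. Zariski, P. Samuel, *Commutative Algebra* II (1960), Ch. VI §12, Thm. 24 and Thm. 25 with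
  its Corollary (PDF pp. 100–101 of the held copy). [ZariskiSamuel1960]

No definitions; nothing of `GeneralizedStabilityHenselizedRational.lean` is restated.
-/

noncomputable section

open IsLocalRing

namespace Literature.AlgebraicGeometry.Resolution

universe u

/-! ### The ramification lemma (ZS VI §12, proof of Thm. 24) -/

section Ramification

variable {N : Type*} [Field N] {Γ₀ : Type*} [LinearOrderedCommGroupWithZero Γ₀]
  (v : Valuation N Γ₀)

/-- If `v(σ x - x) < v(x)` for all `x ≠ 0`, the same holds for every power `σ^i` of the ring
endomorphism `σ` (`σ^{i+1} x - x = (σ z - z) + (z - x)` with `z = σ^i x`, `v(z) = v(x)`).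
[folklore] -/
theorem valuation_pow_apply_sub_lt (σ : N →+* N) (hram : ∀ x, x ≠ 0 → v (σ x - x) < v x) :
    ∀ (i : ℕ) (x : N), x ≠ 0 → v ((σ ^ i) x - x) < v x := by
  intro i
  induction i with
  | zero =>
    intro x hx
    rw [pow_zero, RingHom.coe_one, id_eq, sub_self, map_zero]
    exact (Valuation.pos_iff v).mpr hx
  | succ i ih =>
    intro x hx
    set z : N := (σ ^ i) x with hz
    have h1 : v (z - x) < v x := ih x hx
    have hvz : v z = v x := by
      have : z = x + (z - x) := by ring
      rw [this]
      exact v.map_add_eq_of_lt_left h1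
    have hz0 : z ≠ 0 := fun h0 => by
      rw [h0, map_zero] at hvz
      exact hx ((map_eq_zero v).mp hvz.symm)
    have h2 : v (σ z - z) < v x := hvz ▸ hram z hz0
    have hstep : (σ ^ (i + 1)) x = σ z := by
      rw [pow_succ', RingHom.coe_mul, Function.comp_apply]
    have : (σ ^ (i + 1)) x - x = (σ z - z) + (z - x) := by rw [hstep]; ring
    rw [this]
    exact v.map_add_lt h2 h1

/-- **The ramification lemma** (the trace argument in the proof of Zariski–Samuel II, Ch. VI
§12, Thm. 24, "`G_V` is a `π`-group"): let `σ` be a ring endomorphism of the valued field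
`(N, v)` with `σ^q = 1`, `v(q) = 1` (i.e. `q` is prime to the residue characteristic) and
`v(σ x - x) < v(x)` for every `x ≠ 0`. Then `σ` is the identity. Proof: with
`T = ∑_{i<q} σ^i` one has `σ ∘ T = T`; if `σ x ≠ x` then `y = q x - T x ≠ 0` and `T y = 0`,
but `T y - q y = ∑_{i<q} (σ^i y - y)` has value `< v(y) = v(q y)`, a contradiction.
[cite: ZariskiSamuel1960, Ch. VI §12, Thm. 24] -/
theorem ringHom_apply_eq_self_of_valuation_sub_lt (σ : N →+* N) {q : ℕ} (hσq : σ ^ q = 1)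
    (hvq : v q = 1) (hram : ∀ x, x ≠ 0 → v (σ x - x) < v x) (x : N) : σ x = x := by
  classical
  by_contra hx
  have hq0 : (q : N) ≠ 0 := fun h0 => by
    rw [h0, map_zero] at hvq
    exact zero_ne_one hvq
  -- the operator `T = ∑_{i<q} σ^i`
  let T : N → N := fun y => ∑ i ∈ Finset.range q, (σ ^ i) y
  have hTfix : ∀ y, σ (T y) = T y := by
    intro y
    simp only [T, map_sum]
    have h1 : ∀ i, σ ((σ ^ i) y) = (σ ^ (i + 1)) y := fun i => by
      rw [pow_succ', RingHom.coe_mul, Function.comp_apply]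
    simp_rw [h1]
    have h2 := Finset.sum_range_succ' (fun i => (σ ^ i) y) q
    have h3 := Finset.sum_range_succ (fun i => (σ ^ i) y) q
    rw [hσq, pow_zero] at *
    rw [h3, RingHom.coe_one, id_eq] at h2
    exact (add_right_cancel h2).symm
  have hTpow : ∀ (i : ℕ) (y : N), (σ ^ i) (T y) = T y := by
    intro i y
    induction i with
    | zero => rw [pow_zero, RingHom.coe_one, id_eq]
    | succ i ih => rw [pow_succ', RingHom.coe_mul, Function.comp_apply, ih, hTfix]
  have hTsub : ∀ a b, T (a - b) = T a - T b := fun a b => by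
    simp only [T, map_sub, Finset.sum_sub_distrib]
  have hTmul : ∀ a, T ((q : N) * a) = (q : N) * T a := fun a => by
    simp only [T, map_mul, map_natCast, Finset.mul_sum]
  have hTT : ∀ a, T (T a) = (q : N) * T a := fun a => by
    have : T (T a) = ∑ i ∈ Finset.range q, T a := Finset.sum_congr rfl fun i _ => hTpow i a
    rw [this, Finset.sum_const, Finset.card_range, nsmul_eq_mul]
  -- `y = q x - T x ≠ 0` has `T y = 0`
  set y : N := (q : N) * x - T x with hy
  have hy0 : y ≠ 0 := by
    intro hy0
    have hqx : (q : N) * x = T x := sub_eq_zero.mp hy0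
    have h1 : σ ((q : N) * x) = (q : N) * x := by rw [hqx, hTfix]
    rw [map_mul, map_natCast] at h1
    exact hx (mul_left_cancel₀ hq0 h1)
  have hTy : T y = 0 := by
    rw [hy, hTsub, hTmul, hTT, sub_self]
  -- but `v(T y - q y) < v(y)`
  have hvy0 : v y ≠ 0 := (Valuation.ne_zero_iff v).mpr hy0
  have hlt : v (T y - (q : N) * y) < v y := by
    have hsum : T y - (q : N) * y = ∑ i ∈ Finset.range q, ((σ ^ i) y - y) := by
      simp only [T, Finset.sum_sub_distrib, Finset.sum_const, Finset.card_range, nsmul_eq_mul]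
    rw [hsum]
    exact v.map_sum_lt hvy0 fun i _ => valuation_pow_apply_sub_lt v σ hram i y hy0
  rw [hTy, zero_sub, Valuation.map_neg, map_mul, hvq, one_mul] at hlt
  exact lt_irrefl _ hlt

end Ramification

/-! ### Embeddings over a henselian subfield preserve the valuation -/

section Henselian

variable {Ω : Type u} [Field Ω] (V : ValuationSubring Ω) {F : Subfield Ω}
variable {E : Type u} [Field E] [Algebra F E] [Algebra E Ω] [IsScalarTower F E Ω]

/-- **Embeddings over a henselian field preserve the valuation ring**: if `(F, V ∩ F)` is
henselian, `E` is an algebraic extension of `F` inside `Ω` and `φ : E → Ω` is an `F`-embedding,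
then `φ z ∈ V ↔ z ∈ V` (both `φ⁻¹(V)` and `V ∩ E` lie over `V ∩ F`; Kuhlmann 2010, §1.1:
henselian iff "the extension of `v` from `K` to every algebraic extension field is unique").
[cite: Kuhlmann2010, Section 1.1] -/
theorem IsHenselianField.mem_iff_of_algHom [Algebra.IsAlgebraic F E]
    (hF : IsHenselianField F (V.comap (algebraMap F Ω))) (φ : E →ₐ[F] Ω) (z : E) :
    φ z ∈ V ↔ algebraMap E Ω z ∈ V := by
  have h : V.comap φ.toRingHom = V.comap (algebraMap E Ω) := by
    refine hF.eq_of_comap_eq (L := E) ?_ ?_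
    · ext c
      simp only [ValuationSubring.mem_comap]
      change φ (algebraMap F E c) ∈ V ↔ _
      rw [φ.commutes]
    · ext c
      simp only [ValuationSubring.mem_comap]
      rw [← IsScalarTower.algebraMap_apply]
  have := SetLike.ext_iff.mp h z
  simp only [ValuationSubring.mem_comap] at this
  exact this

/-- Over a henselian `F`, the valuations `v ∘ φ` and `v|_E` of an algebraic `E` are equivalent.
[cite: Kuhlmann2010, Section 1.1] -/
theorem IsHenselianField.isEquiv_comap_algHom [Algebra.IsAlgebraic F E]
    (hF : IsHenselianField F (V.comap (algebraMap F Ω))) (φ : E →ₐ[F] Ω) :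
    (V.valuation.comap φ.toRingHom).IsEquiv (V.valuation.comap (algebraMap E Ω)) := by
  rw [Valuation.isEquiv_iff_valuationSubring]
  ext z
  rw [Valuation.mem_valuationSubring_iff, Valuation.mem_valuationSubring_iff,
    Valuation.comap_apply, Valuation.comap_apply, ValuationSubring.valuation_le_one_iff,
    ValuationSubring.valuation_le_one_iff]
  exact hF.mem_iff_of_algHom V φ z

/-- Over a henselian `F`: `v(φ z) < 1 ↔ v(z) < 1`. [cite: Kuhlmann2010, Section 1.1] -/
theorem IsHenselianField.valuation_algHom_lt_one_iff [Algebra.IsAlgebraic F E]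
    (hF : IsHenselianField F (V.comap (algebraMap F Ω))) (φ : E →ₐ[F] Ω) (z : E) :
    V.valuation (φ z) < 1 ↔ V.valuation (algebraMap E Ω z) < 1 :=
  (hF.isEquiv_comap_algHom V φ).lt_one_iff_lt_one

/-- **Conjugates over a henselian field have the same value**: for `(F, V ∩ F)` henselian,
`E` algebraic over `F` inside `Ω` and an `F`-embedding `φ : E → Ω`, `v(φ z) = v(z)` for every
`z ∈ E`. (Some power `zⁿ`, `n ≥ 1`, has value in `vF`, say `v(zⁿ) = v(b)`; equivalence of
`v ∘ φ` and `v` on `E` gives `v(φ z)ⁿ = v(b) = v(z)ⁿ`, and `γ ↦ γⁿ` is injective on the value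
group.) [cite: Kuhlmann2010, Section 1.1] -/
theorem IsHenselianField.valuation_algHom_apply [Algebra.IsAlgebraic F E]
    (hF : IsHenselianField F (V.comap (algebraMap F Ω))) (φ : E →ₐ[F] Ω) (z : E) :
    V.valuation (φ z) = V.valuation (algebraMap E Ω z) := by
  by_cases hz0 : z = 0
  · rw [hz0, map_zero, map_zero, map_zero, map_zero]
  have hinj : Function.Injective (algebraMap E Ω) := (algebraMap E Ω).injective
  have hz0' : algebraMap E Ω z ≠ 0 := (map_ne_zero_iff _ hinj).mpr hz0
  have halg : IsAlgebraic F (algebraMap E Ω z) := by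
    have h1 : IsAlgebraic F z := Algebra.IsAlgebraic.isAlgebraic z
    exact (isAlgebraic_algebraMap_iff (R := F) (A := Ω) hinj).mpr h1
  obtain ⟨n, hn0, b, hbF, hb⟩ := exists_valuation_pow_eq_of_isAlgebraic V halg hz0'
  have heq := (hF.isEquiv_comap_algHom V φ).eq_iff (r := z ^ n) (s := algebraMap F E ⟨b, hbF⟩)
  simp only [Valuation.comap_apply] at heq
  have h2 : V.valuation (algebraMap E Ω (z ^ n)) =
      V.valuation (algebraMap E Ω (algebraMap F E ⟨b, hbF⟩)) := by
    rw [map_pow, ← IsScalarTower.algebraMap_apply]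
    exact hb
  have h1 := heq.mpr h2
  change V.valuation (φ (z ^ n)) = V.valuation (φ (algebraMap F E ⟨b, hbF⟩)) at h1
  rw [map_pow, φ.commutes, map_pow] at h1
  rw [map_pow, map_pow, ← IsScalarTower.algebraMap_apply] at h2
  have h3 : V.valuation (φ z) ^ n = V.valuation (algebraMap E Ω z) ^ n := h1.trans h2.symm
  exact pow_left_injective hn0 h3

omit [Algebra E Ω] [IsScalarTower F E Ω] in
/-- **Kuhlmann 2010, Lemma 2.3 (first part), inside `Ω`**: if `(F, V ∩ F)` is henselian and
`S ≥ F` is algebraic over `F`, then `(S, V ∩ S)` is henselian. [cite: Kuhlmann2010, Lemma 2.3] -/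
theorem IsHenselianField.of_subfield_le {S : Subfield Ω} (h : F ≤ S)
    (hF : IsHenselianField F (V.comap (algebraMap F Ω))) (halg : ∀ a ∈ S, IsAlgebraic F a) :
    IsHenselianField S (V.comap (algebraMap S Ω)) := by
  letI : Algebra F S := (Subfield.inclusion h).toAlgebra
  haveI : Algebra.IsAlgebraic F S := relAlgebraic_of_forall h halg
  exact hF.of_isAlgebraic (V.comap (algebraMap S Ω)) (by ext y; rfl)

end Henselian

/-! ### Immediate extensions: automorphisms move every element by less than its value -/

section Immediate

variable {Ω : Type u} [Field Ω] (V : ValuationSubring Ω)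

/-- For an IMMEDIATE extension `M ≤ N` inside `(Ω, V)` (`vN = vM`, `Nv = Mv`) and a ring
endomorphism `s` of `N` fixing `M` pointwise and preserving values, `v(s x - x) < v(x)` for all
`x ≠ 0`: indeed `x = c·d + r` with `c, d ∈ M` (`v(x) = v(c)`, `d` a unit with the residue of
`x/c`) and `v(r) < v(x)`, so `s x - x = s r - r`. (The computation behind "`G_T = G_V`" for an
immediate extension, ZS VI §12.) [folklore] -/
theorem valuation_sub_lt_of_isImmediateOver {M N : Subfield Ω} (h : M ≤ N)
    (himm : IsImmediateOver V M N) (s : N →+* N) (hsM : ∀ c : N, (c : Ω) ∈ M → s c = c)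
    (hsv : ∀ z : N, V.valuation ((s z : N) : Ω) = V.valuation (z : Ω)) (x : N) (hx : x ≠ 0) :
    V.valuation (((s x : N) : Ω) - x) < V.valuation (x : Ω) := by
  have hx0 : (x : Ω) ≠ 0 := fun h0 => hx (Subtype.ext h0)
  -- `v(x) = v(c)` with `c ∈ M`
  obtain ⟨c, hcM, hc⟩ := himm.1 x x.2 hx0
  have hc0 : c ≠ 0 := by
    rintro rfl
    rw [map_zero, map_eq_zero] at hc
    exact hx0 hc
  have hvc0 : V.valuation c ≠ 0 := (map_ne_zero V.valuation).mpr hc0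
  -- `w = x / c` is a unit of `V`, with residue the residue of some `d ∈ V ∩ M`
  have hwV : (x : Ω) / c ∈ V := by
    rw [← V.valuation_le_one_iff, map_div₀, hc, div_self hvc0]
  have hwres : residue V ⟨(x : Ω) / c, hwV⟩ ∈ resField V N :=
    residue_mem_resField V ⟨(x : Ω) / c, hwV⟩ (N.div_mem x.2 (h hcM))
  obtain ⟨d, hdM, hd⟩ := (mem_resField_iff V M _).mp (himm.2 hwres)
  have hlt : V.valuation ((x : Ω) / c - d) < 1 := by
    have h1 : residue V (⟨(x : Ω) / c, hwV⟩ - d) = 0 := by rw [map_sub, hd, sub_self]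
    rw [residue_eq_zero_iff, ValuationSubring.valuation_lt_one_iff] at h1
    exact h1
  -- `x = c d + r` with `r = c (x/c - d)`, `v(r) < v(x)`
  let cN : N := ⟨c, h hcM⟩
  let dN : N := ⟨(d : Ω), h hdM⟩
  have hcN0 : cN ≠ 0 := fun h0 => hc0 (congrArg Subtype.val h0)
  set r : N := cN * (x / cN - dN) with hr
  have hxr : x = cN * dN + r := by
    rw [hr, mul_sub, mul_div_cancel₀ x hcN0]
    ring
  have hvr : V.valuation (r : Ω) < V.valuation (x : Ω) := by
    have hcoe : (r : Ω) = c * ((x : Ω) / c - d) := rfl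
    rw [hcoe, map_mul, hc, mul_comm]
    calc V.valuation ((x : Ω) / c - d) * V.valuation c < 1 * V.valuation c :=
          mul_lt_mul_of_pos_right hlt (zero_lt_iff.mpr hvc0)
      _ = V.valuation c := one_mul _
  have hsx : s x - x = s r - r := by
    have hfix : s (cN * dN) = cN * dN := hsM (cN * dN) (M.mul_mem hcM hdM)
    conv_lhs => rw [hxr]
    rw [map_add, hfix]
    ring
  have hcoe : ((s x : N) : Ω) - x = ((s r : N) : Ω) - r := by
    have := congrArg (fun t : N => (t : Ω)) hsx
    simpa only [Subfield.coe_sub] using this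
  rw [hcoe]
  refine lt_of_le_of_lt (V.valuation.map_sub _ _) (max_lt ?_ hvr)
  rw [hsv r]
  exact hvr

end Immediate

end Literature.AlgebraicGeometry.Resolution
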